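import Summits.ValiantsHypothesis.ValiantsHypothesis.Theses.OneNatPerBit

/-!
# Route `OneNatPerBit`, item `stmt-ValiantsHypothesis-10320` (`SharpImpliesExp`, support)

`CorrelationLaw → ExpCorrelationLaw`: the sharp one-nat-per-bit law (squared cosine to `per_n`
at most `C · n^C · e^{-n} · (s + n²)^{1/ln 2}`) implies the exchange-rate-free exponential law
with `θ = e^{-1}` and polynomial exponent `C + 4`, because for `n ≥ 1` and `s ≥ 0`
`n^C ≤ (s + n)^C` and `(s + n²)^{1/ln 2} ≤ (s + n²)² ≤ (s + n)⁴` (using `ln 2 ≥ 1/2` and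
`s + n² ≤ (s + n)²`).  Pure bookkeeping with `Real.rpow`; no literature input.
-/

-- single-conjunct layout: Sub = Summit, duplicated namespace component intended
set_option linter.dupNamespace false

namespace Summit.ValiantsHypothesis.ValiantsHypothesis.Theorems

open Summit.ValiantsHypothesis.ValiantsHypothesis.Theses.OneNatPerBit

/-- The elementary polynomial bookkeeping behind `SharpImpliesExp`: for a natural exponent `C`,
`n ≥ 1` and `s ≥ 0`, `C · n^C · (s + n²)^{1/ln 2} ≤ (C + 4) · (s + n)^{C + 4}`. -/
theorem sharpImpliesExp_poly_bound (C : ℕ) {n s : ℝ} (hn : 1 ≤ n) (hs : 0 ≤ s) :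
    (C : ℝ) * n ^ C * (s + n ^ 2) ^ (1 / Real.log 2) ≤
      ((C + 4 : ℕ) : ℝ) * (s + n) ^ (C + 4) := by
  have hn0 : 0 ≤ n := le_trans zero_le_one hn
  have h1 : (C : ℝ) ≤ ((C + 4 : ℕ) : ℝ) := by exact_mod_cast Nat.le_add_right C 4
  have h2 : n ≤ s + n := le_add_of_nonneg_left hs
  have hbase : 1 ≤ s + n ^ 2 := by nlinarith
  have hexp : 1 / Real.log 2 ≤ 2 := by
    rw [div_le_iff₀ (Real.log_pos one_lt_two)]
    linarith [Real.log_two_gt_d9]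
  have h3 : (s + n ^ 2) ^ (1 / Real.log 2) ≤ (s + n) ^ 4 := by
    calc (s + n ^ 2) ^ (1 / Real.log 2) ≤ (s + n ^ 2) ^ (2 : ℝ) :=
          Real.rpow_le_rpow_of_exponent_le hbase hexp
      _ = (s + n ^ 2) ^ 2 := Real.rpow_two _
      _ ≤ ((s + n) ^ 2) ^ 2 := by
          have h4 : s + n ^ 2 ≤ (s + n) ^ 2 := by nlinarith
          exact pow_le_pow_left₀ (le_trans zero_le_one hbase) h4 2
      _ = (s + n) ^ 4 := by ring
  have hsn : 0 ≤ s + n := by linarith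
  calc (C : ℝ) * n ^ C * (s + n ^ 2) ^ (1 / Real.log 2)
      ≤ ((C + 4 : ℕ) : ℝ) * (s + n) ^ C * (s + n) ^ 4 := by
        gcongr
    _ = ((C + 4 : ℕ) : ℝ) * (s + n) ^ (C + 4) := by ring

/-- Settles `stmt-ValiantsHypothesis-10320` (support of route `OneNatPerBit`):
`CorrelationLaw → ExpCorrelationLaw`, with witnesses `C' = C + 4` and `θ = e^{-1}`
(`0 < e^{-1} < 1`, `e^{-n} = (e^{-1})^n`, and `sharpImpliesExp_poly_bound`). -/
theorem sharpImpliesExp_proof :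
    Summit.ValiantsHypothesis.ValiantsHypothesis.Theses.OneNatPerBit.SharpImpliesExp := by
  unfold SharpImpliesExp CorrelationLaw ExpCorrelationLaw
  rintro ⟨C, hC⟩
  refine ⟨C + 4, Real.exp (-1), Real.exp_pos _, Real.exp_lt_one_iff.mpr (by norm_num), ?_⟩
  intro n hn P hP
  have h := hC n hn P hP
  have hn' : (1 : ℝ) ≤ (n : ℝ) := by exact_mod_cast hn
  have hs : (0 : ℝ) ≤ (P.size : ℝ) := Nat.cast_nonneg _
  have hkey := sharpImpliesExp_poly_bound C hn' hs
  have hθ : Real.exp (-1) ^ n = Real.exp (-(n : ℝ)) := by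
    rw [← Real.exp_nat_mul]; congr 1; ring
  have hsum : (0 : ℝ) ≤ P.eval.support.sum (fun m => ‖MvPolynomial.coeff m P.eval‖ ^ 2) :=
    Finset.sum_nonneg (fun m _ => by positivity)
  refine le_trans h ?_
  calc (C : ℝ) * (n : ℝ) ^ C * Real.exp (-(n : ℝ)) *
        ((P.size : ℝ) + (n : ℝ) ^ 2) ^ (1 / Real.log 2) * (n.factorial : ℝ) *
        P.eval.support.sum (fun m => ‖MvPolynomial.coeff m P.eval‖ ^ 2)
      = ((C : ℝ) * (n : ℝ) ^ C * ((P.size : ℝ) + (n : ℝ) ^ 2) ^ (1 / Real.log 2)) *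
          (Real.exp (-(n : ℝ)) * (n.factorial : ℝ) *
            P.eval.support.sum (fun m => ‖MvPolynomial.coeff m P.eval‖ ^ 2)) := by ring
    _ ≤ (((C + 4 : ℕ) : ℝ) * ((P.size : ℝ) + (n : ℝ)) ^ (C + 4)) *
          (Real.exp (-(n : ℝ)) * (n.factorial : ℝ) *
            P.eval.support.sum (fun m => ‖MvPolynomial.coeff m P.eval‖ ^ 2)) :=
        mul_le_mul_of_nonneg_right hkey (by positivity)
    _ = ((C + 4 : ℕ) : ℝ) * ((P.size : ℝ) + (n : ℝ)) ^ (C + 4) * Real.exp (-1) ^ n *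
          (n.factorial : ℝ) *
          P.eval.support.sum (fun m => ‖MvPolynomial.coeff m P.eval‖ ^ 2) := by
        rw [hθ]; ring

end Summit.ValiantsHypothesis.ValiantsHypothesis.Theorems
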